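import Summits.CriticalPhenomena.CardyFormulaZ2.Theorems.CardyBoundaryCoulombGasRectilinearCardyStubBoundaryFeetPart5
import HarnessLib

/-!
# Stub `stub_boundaryFeet` of line `excursion-kernel-covariance` — Part 6:
# feet of the chain darts inside a wedge (crux `RectilinearCardy`, stmt-CriticalPhenomena-5660)

Inside the closure chart of an oriented wedge (apex `p`, frame `K`, type `m`, thresholds
`X = bftX m δ re(p(-i)^K)`, `Y = ⌈im(p(-i)^K)/δ⌉`) the foot of every chain dart
`(bftVert m K X Y ι, K + bftKoff m ι)` is the orthogonal projection of its mesh point onto the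
local frontier, straight ahead within `δ`: it sits at the frame point `p + w i^K` where `w` is
real, `w = bftSposZ …` (forward darts: outgoing ray, or the line of a flat point;
`bft_foot_fwd`) or imaginary, `w = ∓ bftSposZ … · i` (backward darts: incoming ray of a convex
/ reflex corner; `bft_foot_bwd_one`, `bft_foot_bwd_three`); `bft_of_frame` reads a point off its
frame coordinate. All [folklore].
-/

noncomputable section

open Set Filter Metric Topology
open Literature.Probability.RandomPlanarGeometry
open Literature.Probability.LatticeModels Literature.Probability.LatticeModels.CollarLegModel
open Summit.CriticalPhenomena.CardyFormulaZ2.Cruxes.BoundaryDefectGaussianR.RainbowMonomialsInExcursionKernels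

namespace Summit.CriticalPhenomena.CardyFormulaZ2.Cruxes.RectilinearCardy.ExcursionKernelCovariance

/-! ### Frame algebra -/

/-- Reading a point from its frame coordinate: `(z - p)(-i)^K = w → z = p + w i^K`. [folklore] -/
theorem bft_of_frame {z p w : ℂ} {K : ℕ} (h : (z - p) * (-Complex.I) ^ K = w) :
    z = p + w * Complex.I ^ K := by
  have : (z - p) * (-Complex.I) ^ K * Complex.I ^ K = w * Complex.I ^ K := by rw [h]
  rw [mul_assoc, neg_I_pow_mul_I_pow, mul_one] at this
  rw [← this]; ring

/-! ### Feet of the chain darts -/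

/-- **Foot of a forward chain dart** (outgoing rail of a corner, or the rail of a flat point):
the orthogonal projection straight ahead, at the real frame point `bftSposZ`. [folklore] -/
theorem bft_foot_fwd (D : JordanDomain) {δ : ℝ} (hδ : 0 < δ) (K : Fin 4) {p : ℂ} {r : ℝ}
    {m : ℕ} (hm : m = 1 ∨ m = 2 ∨ m = 3)
    (hclos : ∀ z, dist z p < r → (z ∈ closure D.carrier ↔
      (m = 1 → 0 ≤ ((z - p) * (-Complex.I) ^ (K : ℕ)).re ∧ 0 ≤ ((z - p) * (-Complex.I) ^ (K : ℕ)).im) ∧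
        (m = 2 → 0 ≤ ((z - p) * (-Complex.I) ^ (K : ℕ)).im) ∧
        (m = 3 → 0 ≤ ((z - p) * (-Complex.I) ^ (K : ℕ)).im ∨
          ((z - p) * (-Complex.I) ^ (K : ℕ)).re ≤ 0)))
    {ι : ℤ} (hf : m = 2 ∨ 0 ≤ ι)
    (hnear : ∀ z, dist z (bftMesh δ (bftVert m K (bftX m δ (p * (-Complex.I) ^ (K : ℕ)).re)
      ⌈(p * (-Complex.I) ^ (K : ℕ)).im / δ⌉ ι)) ≤ δ → dist z p < r) :
    bftPhi D δ (bftVert m K (bftX m δ (p * (-Complex.I) ^ (K : ℕ)).re) ⌈(p * (-Complex.I) ^ (K : ℕ)).im / δ⌉ ι,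
        K + bftKoff m ι) =
      p + ((bftSposZ m δ (p * (-Complex.I) ^ (K : ℕ)).re (p * (-Complex.I) ^ (K : ℕ)).im
        (bftX m δ (p * (-Complex.I) ^ (K : ℕ)).re) ⌈(p * (-Complex.I) ^ (K : ℕ)).im / δ⌉ ι : ℝ) : ℂ) *
        Complex.I ^ (K : ℕ) ∧
    (m = 2 ∨ 0 ≤ bftSposZ m δ (p * (-Complex.I) ^ (K : ℕ)).re (p * (-Complex.I) ^ (K : ℕ)).im
        (bftX m δ (p * (-Complex.I) ^ (K : ℕ)).re) ⌈(p * (-Complex.I) ^ (K : ℕ)).im / δ⌉ ι) := by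
  set Pre := (p * (-Complex.I) ^ (K : ℕ)).re with hPre
  set Pim := (p * (-Complex.I) ^ (K : ℕ)).im with hPim
  set X := bftX m δ Pre with hX
  set Y := ⌈Pim / δ⌉ with hY
  set v := bftVert m K X Y ι with hv
  obtain ⟨c1, c2, f1, f2⟩ := bft_round hδ Pre
  obtain ⟨d1, d2, -, -⟩ := bft_round hδ Pim
  rw [(bft_vert_fwd K X Y hf).2]
  have hvf := (bft_vert_fwd (m := m) K X Y hf).1
  rw [← hv] at hvf
  have hcoord := tp_rail_coords K (X + (if m = 3 then 1 else 0) + ι) Y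
  rw [← hvf] at hcoord
  obtain ⟨hal, hpe⟩ := hcoord
  -- frame coordinates along the segment
  have hfr : ∀ s : ℝ, ((bftMesh δ v + (s : ℂ) * bftDirC (K + 3) - p) * (-Complex.I) ^ (K : ℕ)).re =
      δ * ((X + (if m = 3 then 1 else 0) + ι : ℤ) : ℝ) - Pre ∧
      ((bftMesh δ v + (s : ℂ) * bftDirC (K + 3) - p) * (-Complex.I) ^ (K : ℕ)).im =
      δ * ((Y : ℤ) : ℝ) - Pim - s := by
    intro s
    have e : (bftMesh δ v + (s : ℂ) * bftDirC (K + 3) - p) * (-Complex.I) ^ (K : ℕ) =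
        (bftMesh δ v - p) * (-Complex.I) ^ (K : ℕ) + (s : ℂ) * (bftDirC (K + 3) * (-Complex.I) ^ (K : ℕ)) := by
      ring
    rw [e, bft_dirC_frame K 3]
    have h3 : Complex.I ^ ((3 : Fin 4) : ℕ) = -Complex.I := by
      show Complex.I ^ 3 = -Complex.I
      rw [pow_succ, pow_two, Complex.I_mul_I]; ring
    rw [h3, Complex.add_re, Complex.add_im, (bft_mesh_frame_sub K δ v p).1,
      (bft_mesh_frame_sub K δ v p).2, hal, hpe, ← hPre, ← hPim]
    simp only [Complex.mul_re, Complex.mul_im, Complex.neg_re, Complex.neg_im, Complex.I_re,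
      Complex.I_im, Complex.ofReal_re, Complex.ofReal_im]
    constructor <;> ring
  have hι0 : m = 2 ∨ (0 : ℝ) ≤ ι := by
    rcases hf with h | h
    · exact Or.inl h
    · right; exact_mod_cast h
  have hsign : m = 2 ∨ 0 ≤ δ * ((X + (if m = 3 then 1 else 0) + ι : ℤ) : ℝ) - Pre := by
    rcases hm with rfl | rfl | rfl
    · right
      rw [if_neg (by norm_num)]
      rcases hι0 with h | hι
      · norm_num at h
      have : (X : ℝ) = ⌈Pre / δ⌉ := by rw [hX, bftX, if_neg (by norm_num)]
      push_cast
      nlinarith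
    · exact Or.inl rfl
    · right
      rw [if_pos rfl]
      rcases hι0 with h | hι
      · norm_num at h
      have : (X : ℝ) = ⌊Pre / δ⌋ := by rw [hX, bftX, if_pos rfl]
      push_cast
      nlinarith
  -- the foot abscissa
  have hfoot : bftFoot D δ (v, K + 3) = δ * ((Y : ℤ) : ℝ) - Pim := by
    refine bft_foot_eq D (v, K + 3) d1 d2.le fun s hs => ?_
    have hin := bft_seg_in_disc v (K + 3) hs hnear
    show bftMesh δ v + (s : ℂ) * bftDirC (K + 3) ∈ closure D.carrier ↔ s ≤ δ * ((Y : ℤ) : ℝ) - Pim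
    rw [hclos _ hin, (hfr s).1, (hfr s).2]
    rcases hm with rfl | rfl | rfl
    · rw [tp_csec_one]
      rcases hsign with h | h
      · norm_num at h
      · constructor
        · rintro ⟨-, h2⟩; linarith
        · intro h2; exact ⟨h, by linarith⟩
    · rw [tp_csec_two]; constructor <;> intro h <;> linarith
    · rw [tp_csec_three]
      have hpos : 0 < δ * ((X + (if 3 = 3 then 1 else 0) + ι : ℤ) : ℝ) - Pre := by
        rw [if_pos rfl]
        rcases hι0 with h | hι
        · norm_num at h
        have : (X : ℝ) = ⌊Pre / δ⌋ := by rw [hX, bftX, if_pos rfl]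
        push_cast
        nlinarith
      constructor
      · rintro (h2 | h2)
        · linarith
        · linarith
      · intro h2; left; linarith
  have hsposZ : bftSposZ m δ Pre Pim X Y ι = δ * ((X + (if m = 3 then 1 else 0) + ι : ℤ) : ℝ) - Pre := by
    rw [bftSposZ, if_pos hf]
  refine ⟨?_, hsposZ ▸ hsign⟩
  apply bft_of_frame
  show (bftMesh δ v + ((bftFoot D δ (v, K + 3) : ℝ) : ℂ) * bftDirC (K + 3) - p) * (-Complex.I) ^ (K : ℕ) = _
  rw [hfoot]
  refine Complex.ext ?_ ?_
  · rw [(hfr _).1, hsposZ, Complex.ofReal_re]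
  · rw [(hfr _).2, Complex.ofReal_im]; ring

/-- **Foot of a backward chain dart of a quadrant** (incoming rail of a convex corner): the
orthogonal projection straight ahead, at the imaginary frame point `-bftSposZ · i`. [folklore] -/
theorem bft_foot_bwd_one (D : JordanDomain) {δ : ℝ} (hδ : 0 < δ) (K : Fin 4) {p : ℂ} {r : ℝ}
    (hclos : ∀ z, dist z p < r → (z ∈ closure D.carrier ↔
      ((1 : ℕ) = 1 → 0 ≤ ((z - p) * (-Complex.I) ^ (K : ℕ)).re ∧ 0 ≤ ((z - p) * (-Complex.I) ^ (K : ℕ)).im) ∧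
        ((1 : ℕ) = 2 → 0 ≤ ((z - p) * (-Complex.I) ^ (K : ℕ)).im) ∧
        ((1 : ℕ) = 3 → 0 ≤ ((z - p) * (-Complex.I) ^ (K : ℕ)).im ∨
          ((z - p) * (-Complex.I) ^ (K : ℕ)).re ≤ 0)))
    {ι : ℤ} (hι : ι < 0)
    (hnear : ∀ z, dist z (bftMesh δ (bftVert 1 K (bftX 1 δ (p * (-Complex.I) ^ (K : ℕ)).re)
      ⌈(p * (-Complex.I) ^ (K : ℕ)).im / δ⌉ ι)) ≤ δ → dist z p < r) :
    bftPhi D δ (bftVert 1 K (bftX 1 δ (p * (-Complex.I) ^ (K : ℕ)).re) ⌈(p * (-Complex.I) ^ (K : ℕ)).im / δ⌉ ι,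
        K + bftKoff 1 ι) =
      p + ((-bftSposZ 1 δ (p * (-Complex.I) ^ (K : ℕ)).re (p * (-Complex.I) ^ (K : ℕ)).im
        (bftX 1 δ (p * (-Complex.I) ^ (K : ℕ)).re) ⌈(p * (-Complex.I) ^ (K : ℕ)).im / δ⌉ ι : ℝ) : ℂ) *
        Complex.I * Complex.I ^ (K : ℕ) ∧
    bftSposZ 1 δ (p * (-Complex.I) ^ (K : ℕ)).re (p * (-Complex.I) ^ (K : ℕ)).im
        (bftX 1 δ (p * (-Complex.I) ^ (K : ℕ)).re) ⌈(p * (-Complex.I) ^ (K : ℕ)).im / δ⌉ ι ≤ 0 := by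
  set Pre := (p * (-Complex.I) ^ (K : ℕ)).re with hPre
  set Pim := (p * (-Complex.I) ^ (K : ℕ)).im with hPim
  set X := bftX 1 δ Pre with hX
  set Y := ⌈Pim / δ⌉ with hY
  set v := bftVert 1 K X Y ι with hv
  obtain ⟨c1, c2, -, -⟩ := bft_round hδ Pre
  obtain ⟨d1, d2, -, -⟩ := bft_round hδ Pim
  have hXc : (X : ℝ) = ⌈Pre / δ⌉ := by rw [hX, bftX, if_neg (by norm_num)]
  rw [(bft_vert_bwd_one K X Y hι).2]
  have hvb := (bft_vert_bwd_one K X Y hι).1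
  rw [← hv] at hvb
  have hcoord := tp_rail_coords K X (Y - 1 - ι)
  rw [← hvb] at hcoord
  obtain ⟨hal, hpe⟩ := hcoord
  have hι' : (ι : ℝ) ≤ -1 := by exact_mod_cast (show ι ≤ -1 by omega)
  have hfr : ∀ s : ℝ, ((bftMesh δ v + (s : ℂ) * bftDirC (K + 2) - p) * (-Complex.I) ^ (K : ℕ)).re =
      δ * X - Pre - s ∧
      ((bftMesh δ v + (s : ℂ) * bftDirC (K + 2) - p) * (-Complex.I) ^ (K : ℕ)).im =
      δ * ((Y - 1 - ι : ℤ) : ℝ) - Pim := by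
    intro s
    have e : (bftMesh δ v + (s : ℂ) * bftDirC (K + 2) - p) * (-Complex.I) ^ (K : ℕ) =
        (bftMesh δ v - p) * (-Complex.I) ^ (K : ℕ) + (s : ℂ) * (bftDirC (K + 2) * (-Complex.I) ^ (K : ℕ)) := by
      ring
    rw [e, bft_dirC_frame K 2]
    have h2 : Complex.I ^ ((2 : Fin 4) : ℕ) = -1 := by
      show Complex.I ^ 2 = -1
      exact Complex.I_sq
    rw [h2, Complex.add_re, Complex.add_im, (bft_mesh_frame_sub K δ v p).1,
      (bft_mesh_frame_sub K δ v p).2, hal, hpe, ← hPre, ← hPim]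
    simp only [Complex.mul_re, Complex.mul_im, Complex.neg_re, Complex.neg_im, Complex.one_re,
      Complex.one_im, Complex.ofReal_re, Complex.ofReal_im]
    constructor <;> ring
  have him : 0 ≤ δ * ((Y - 1 - ι : ℤ) : ℝ) - Pim := by push_cast; nlinarith
  have hfoot : bftFoot D δ (v, K + 2) = δ * X - Pre := by
    refine bft_foot_eq D (v, K + 2) (by rw [hXc]; exact c1) (by rw [hXc]; exact c2.le) fun s hs => ?_
    have hin := bft_seg_in_disc v (K + 2) hs hnear
    show bftMesh δ v + (s : ℂ) * bftDirC (K + 2) ∈ closure D.carrier ↔ s ≤ δ * ↑X - Pre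
    rw [hclos _ hin, (hfr s).1, (hfr s).2, tp_csec_one]
    constructor
    · rintro ⟨h1, -⟩; linarith
    · intro h1; exact ⟨by linarith, him⟩
  have hsposZ : bftSposZ 1 δ Pre Pim X Y ι = -(δ * ((Y - 1 - ι : ℤ) : ℝ) - Pim) := by
    rw [bftSposZ, if_neg (by omega), if_neg (by norm_num)]
  refine ⟨?_, by rw [hsposZ]; linarith⟩
  apply bft_of_frame
  show (bftMesh δ v + ((bftFoot D δ (v, K + 2) : ℝ) : ℂ) * bftDirC (K + 2) - p) * (-Complex.I) ^ (K : ℕ) = _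
  rw [hfoot, hsposZ, neg_neg]
  refine Complex.ext ?_ ?_
  · rw [(hfr _).1]
    simp only [Complex.mul_re, Complex.I_re, Complex.I_im, Complex.ofReal_re, Complex.ofReal_im]
    ring
  · rw [(hfr _).2]
    simp only [Complex.mul_im, Complex.I_re, Complex.I_im, Complex.ofReal_re, Complex.ofReal_im]
    ring

/-- **Foot of a backward chain dart of a co-quadrant** (incoming rail of a reflex corner): the
orthogonal projection straight ahead, at the imaginary frame point `bftSposZ · i` (negative).
[folklore] -/
theorem bft_foot_bwd_three (D : JordanDomain) {δ : ℝ} (hδ : 0 < δ) (K : Fin 4) {p : ℂ} {r : ℝ}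
    (hclos : ∀ z, dist z p < r → (z ∈ closure D.carrier ↔
      ((3 : ℕ) = 1 → 0 ≤ ((z - p) * (-Complex.I) ^ (K : ℕ)).re ∧ 0 ≤ ((z - p) * (-Complex.I) ^ (K : ℕ)).im) ∧
        ((3 : ℕ) = 2 → 0 ≤ ((z - p) * (-Complex.I) ^ (K : ℕ)).im) ∧
        ((3 : ℕ) = 3 → 0 ≤ ((z - p) * (-Complex.I) ^ (K : ℕ)).im ∨
          ((z - p) * (-Complex.I) ^ (K : ℕ)).re ≤ 0)))
    {ι : ℤ} (hι : ι < 0)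
    (hnear : ∀ z, dist z (bftMesh δ (bftVert 3 K (bftX 3 δ (p * (-Complex.I) ^ (K : ℕ)).re)
      ⌈(p * (-Complex.I) ^ (K : ℕ)).im / δ⌉ ι)) ≤ δ → dist z p < r) :
    bftPhi D δ (bftVert 3 K (bftX 3 δ (p * (-Complex.I) ^ (K : ℕ)).re) ⌈(p * (-Complex.I) ^ (K : ℕ)).im / δ⌉ ι,
        K + bftKoff 3 ι) =
      p + ((bftSposZ 3 δ (p * (-Complex.I) ^ (K : ℕ)).re (p * (-Complex.I) ^ (K : ℕ)).im
        (bftX 3 δ (p * (-Complex.I) ^ (K : ℕ)).re) ⌈(p * (-Complex.I) ^ (K : ℕ)).im / δ⌉ ι : ℝ) : ℂ) *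
        Complex.I * Complex.I ^ (K : ℕ) ∧
    bftSposZ 3 δ (p * (-Complex.I) ^ (K : ℕ)).re (p * (-Complex.I) ^ (K : ℕ)).im
        (bftX 3 δ (p * (-Complex.I) ^ (K : ℕ)).re) ⌈(p * (-Complex.I) ^ (K : ℕ)).im / δ⌉ ι < 0 := by
  set Pre := (p * (-Complex.I) ^ (K : ℕ)).re with hPre
  set Pim := (p * (-Complex.I) ^ (K : ℕ)).im with hPim
  set X := bftX 3 δ Pre with hX
  set Y := ⌈Pim / δ⌉ with hY
  set v := bftVert 3 K X Y ι with hv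
  obtain ⟨-, -, f1, f2⟩ := bft_round hδ Pre
  obtain ⟨d1, d2, -, -⟩ := bft_round hδ Pim
  have hXf : (X : ℝ) = ⌊Pre / δ⌋ := by rw [hX, bftX, if_pos rfl]
  rw [(bft_vert_bwd_three K X Y hι).2, add_zero]
  have hvb := (bft_vert_bwd_three K X Y hι).1
  rw [← hv] at hvb
  have hcoord := tp_rail_coords K X (Y + ι)
  rw [← hvb] at hcoord
  obtain ⟨hal, hpe⟩ := hcoord
  have hι' : (ι : ℝ) ≤ -1 := by exact_mod_cast (show ι ≤ -1 by omega)
  have hfr : ∀ s : ℝ, ((bftMesh δ v + (s : ℂ) * bftDirC K - p) * (-Complex.I) ^ (K : ℕ)).re =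
      δ * X - Pre + s ∧
      ((bftMesh δ v + (s : ℂ) * bftDirC K - p) * (-Complex.I) ^ (K : ℕ)).im =
      δ * ((Y + ι : ℤ) : ℝ) - Pim := by
    intro s
    have e : (bftMesh δ v + (s : ℂ) * bftDirC K - p) * (-Complex.I) ^ (K : ℕ) =
        (bftMesh δ v - p) * (-Complex.I) ^ (K : ℕ) + (s : ℂ) * (bftDirC (K + 0) * (-Complex.I) ^ (K : ℕ)) := by
      rw [add_zero]; ring
    rw [e, bft_dirC_frame K 0]
    have h0 : Complex.I ^ ((0 : Fin 4) : ℕ) = 1 := by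
      show Complex.I ^ 0 = 1
      exact pow_zero _
    rw [h0, mul_one, Complex.add_re, Complex.add_im, (bft_mesh_frame_sub K δ v p).1,
      (bft_mesh_frame_sub K δ v p).2, hal, hpe, ← hPre, ← hPim, Complex.ofReal_re, Complex.ofReal_im]
    constructor <;> ring
  have him : δ * ((Y + ι : ℤ) : ℝ) - Pim < 0 := by push_cast; nlinarith
  have hfoot : bftFoot D δ (v, K) = Pre - δ * X := by
    refine bft_foot_eq D (v, K) (by rw [hXf]; exact f1) (by rw [hXf]; exact f2.le) fun s hs => ?_
    have hin := bft_seg_in_disc v K hs hnear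
    show bftMesh δ v + (s : ℂ) * bftDirC K ∈ closure D.carrier ↔ s ≤ Pre - δ * ↑X
    rw [hclos _ hin, (hfr s).1, (hfr s).2, tp_csec_three]
    constructor
    · rintro (h1 | h1)
      · linarith
      · linarith
    · intro h1; right; linarith
  have hsposZ : bftSposZ 3 δ Pre Pim X Y ι = δ * ((Y + ι : ℤ) : ℝ) - Pim := by
    rw [bftSposZ, if_neg (by omega), if_pos rfl]
  refine ⟨?_, by rw [hsposZ]; exact him⟩
  apply bft_of_frame
  show (bftMesh δ v + ((bftFoot D δ (v, K) : ℝ) : ℂ) * bftDirC K - p) * (-Complex.I) ^ (K : ℕ) = _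
  rw [hfoot, hsposZ]
  refine Complex.ext ?_ ?_
  · rw [(hfr _).1]
    simp only [Complex.mul_re, Complex.I_re, Complex.I_im, Complex.ofReal_re, Complex.ofReal_im]
    ring
  · rw [(hfr _).2]
    simp only [Complex.mul_im, Complex.I_re, Complex.I_im, Complex.ofReal_re, Complex.ofReal_im]
    ring

end Summit.CriticalPhenomena.CardyFormulaZ2.Cruxes.RectilinearCardy.ExcursionKernelCovariance

end
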